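import Literature.AnabelianGeometry.AbsoluteAnabelian.AbsTopIII.Thm19KummerTowerBridge
import Literature.AnabelianGeometry.AbsoluteAnabelian.AbsTopIII.Thm19KummerTowerBridgeCore
import Literature.AnabelianGeometry.AbsoluteAnabelian.AbsTopIII.Thm19KummerTowerProofs
import HarnessLib

/-!
# [AbsTopIII] Thm. 1.9 (d): the tower of a tagged system DERIVED from the per-curve laws, and the
# (d)-rows for every law-abiding model (proof-only)

Mochizuki, *Topics in Absolute Anabelian Geometry III*, §1, Theorem 1.9 (d), manuscript pp. 37–38 (lit key
`paper:url-5493eb38cbb7`): "`k̄_NF^× ⊆ K_{Z_NF}^× ↪ lim_{→V} H¹(Π_V, μ_Ẑ(Π_U))` [...] the '`↪`' arises from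
the Kummer map".

Cell abc-iut, sub-DAG `plan/L4/SUBDAG-AbsTopIII-Thm19.md` rows Thm19.d.r8–r10; the BRIDGE of
abc-iut-L4-lead RULINGS #3z/#4a: `NFTower.ofCurveLaws`.  From abc-iut-L4-t1's law structures
(`DescentKummerModel`: cofinite opens `unitRes`/`kummer_natural`, base-change legs `bcUnitRes`/`kummer_bc`,
towers `bcEmb`/`toGeom`/`nfToGeom`, Def. 1.7 image conditions) and the geometric tags of a system
(`GeomTags`, sibling file), THIS FILE constructs the per-system tower `IntrinsicKummerModel.NFTower`
(abc-iut-w5-d213): `exists_nfTower_of_tags` — restriction of units = `unitRes ∘ bcUnitRes`, naturality =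
`kummer_naturality_of_factorization` (bridge core), constants/NF-links from `ord_const`/`isNFConstant_iff`,
the base-field tower from `bcEmb` (coherence `bcEmb_baseRes_coherent`), the function-field tower from
`toGeom` (coherence `toGeom_fieldRes_coherent`), cofinality from the tags.  Consequently the three (d)-rows
hold for EVERY `DescentKummerModel` whose systems are tagged: `DescentKummerModel.thm19d` — from the named
facts `Prop_1_6_i`, `Prop_1_8_i`, `Prop_1_8_ii`, `Prop_1_6_iii_units`, `Prop_1_6_iii_ker`, `Rmk_1_5_4_i` BY
NAME (`thm19d_of_tower`).  No definition, no new named fact; nothing here bears on [IUTchIII] Cor. 3.12.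
-/

noncomputable section

open CategoryTheory

namespace Literature.AnabelianGeometry.AbsoluteAnabelian.AbsTopIII

universe u

namespace DescentKummerModel

variable (N : DescentKummerModel.{u})

/-- **Coherence of the function-field tower along a factored transition**: with
`σ_i := (K_{V_i} ≅ K_{Z_i}) ↪ K_{Z_{k̄}}` (`toGeom` of the leg `Z_i → Z` after `fieldRes`), the restriction
`f ↦ (f ∘ (W → V_i))|_{V_j}` satisfies `σ_j(f|) = σ_i(f)` (`fieldRes_comp`, the square `bcField_fieldRes`,
and `toGeom_comp_bcField`). [cite: MochizukiAbsTopIII2015, Thm 1.9 (d) p.37] -/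
theorem toGeom_fieldRes_coherent {Vj W Zj Vi Zi Z : N.Curve} (hVW : N.IsCofiniteOpen Vj W)
    (hWZ : N.IsCofiniteOpen W Zj) (hj : N.IsCofiniteOpen Vj Zj) (hWV : N.IsBaseChangeOf W Vi)
    (hZZ : N.IsBaseChangeOf Zj Zi) (hi : N.IsCofiniteOpen Vi Zi) (hZi : N.IsBaseChangeOf Zi Z)
    (hZj : N.IsBaseChangeOf Zj Z) (f : N.FunctionField Vi) :
    N.toGeom hZj ((N.fieldRes hj).symm (N.fieldRes hVW (N.bcField hWV f))) =
      N.toGeom hZi ((N.fieldRes hi).symm f) := by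
  letI := N.instGeomField Z
  obtain ⟨f₀, rfl⟩ : ∃ f₀, N.fieldRes hi f₀ = f := ⟨(N.fieldRes hi).symm f, (N.fieldRes hi).apply_symm_apply f⟩
  rw [RingEquiv.symm_apply_apply, N.bcField_fieldRes hWV hZZ hi hWZ f₀]
  have h1 : (N.fieldRes hj).symm (N.fieldRes hVW (N.fieldRes hWZ (N.bcField hZZ f₀))) = N.bcField hZZ f₀ := by
    rw [← N.fieldRes_comp hVW hWZ hj, RingEquiv.symm_apply_apply]
  rw [h1]
  exact congrArg (fun φ : N.FunctionField Zi →+* N.geomField Z => φ f₀) (N.toGeom_comp_bcField hZZ hZi hZj)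

/-- **NF-rationality of a function of a level is detected in `K_{Z_NF}`** (Def. 1.7 (ii) along
`V_i ⊆ Z_i → Z`: `isNFRational_fieldRes`, `isNFRational_iff_mem_range`).
[cite: MochizukiAbsTopIII2015, Def 1.7 p.35] -/
theorem isNFRational_iff_toGeom_mem {Vi Zi Z : N.Curve} (hi : N.IsCofiniteOpen Vi Zi)
    (hZi : N.IsBaseChangeOf Zi Z) (hZ : N.IsNFCurve Z) (hVi : N.IsNFCurve Vi) (g : N.FunctionField Vi) :
    N.IsNFRational Vi g ↔ N.toGeom hZi ((N.fieldRes hi).symm g) ∈ Set.range (N.nfToGeom Z) := by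
  obtain ⟨g₀, rfl⟩ : ∃ g₀, N.fieldRes hi g₀ = g := ⟨(N.fieldRes hi).symm g, (N.fieldRes hi).apply_symm_apply g⟩
  rw [RingEquiv.symm_apply_apply, N.isNFRational_fieldRes hi hVi g₀]
  exact N.isNFRational_iff_mem_range hZi hZ g₀

variable {N} in
/-- **THE BRIDGE: a tagged system of NF-complements over a law-abiding model HAS a tower** (abc-iut-L4-lead
RULING #4a `NFTower.ofCurveLaws`): the per-system data `IntrinsicKummerModel.NFTower` over
`Ω := K_{Z_{k̄}}` — restriction of units along the transitions (`unitRes ∘ bcUnitRes`, injective), the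
NATURALITY of the Kummer maps (`kummer_naturality_of_factorization`), constants are regular units
(`ord_const`), the Def.-1.7 (ii) links, the tower of base fields `k′_i ⊆ k̄` (`bcEmb`) and of function
fields `K_{V_i} ⊆ K_{Z_{k̄}} ⊇ K_{Z_NF}` (`toGeom`, `nfToGeom`) with their coherence, and the system's
cofinality (tags). [cite: MochizukiAbsTopIII2015, Thm 1.9 (d) p.37] -/
theorem exists_nfTower_of_tags {Z : N.Curve} {ι : Type u} [Preorder ι]
    (S : CurveModel.NFComplementSystem N.toCurveModel Z ι) (T : S.GeomTags N)
    (hZ : N.IsNFCurve Z) :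
    ∃ (Ω : Type u) (_ : Field Ω), Nonempty (N.NFTower S Ω) := by
  letI := N.instGeomField Z
  refine ⟨N.geomField Z, inferInstance, ⟨?_⟩⟩
  exact
    { res := fun i j h => (N.unitRes (T.hVW h)).comp (N.bcUnitRes (T.hWV h))
      res_injective := fun i j h => (N.unitRes_injective (T.hVW h)).comp (N.bcUnitRes_injective (T.hWV h))
      naturality := fun i j h f =>
        N.kummer_naturality_of_factorization (T.hVW h) (T.hWZ h) (S.isOpen j) (T.hWV h) (T.hZZ h)
          (S.isOpen i) (S.isProper i) (S.isProper j) (S.bc i) (T.bc_trans h).symm (T.trans_eq h)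
          (S.trans_comm h) (Additive.toMul f)
      const_mem := fun i c => (N.constUnit c).2
      isNFConstant_iff := fun i c => N.isNFConstant_iff (S.isNFCurve i) c
      baseEmb := fun i => (N.bcEmb (T.hZb i)).comp (N.baseRes (S.isOpen i)).symm.toRingHom
      baseEmb_res := fun i j h c =>
        ⟨Units.map (N.baseRes (T.hVW h)).toRingHom.toMonoidHom
            (Units.map (N.bcBase (T.hWV h)).toMonoidHom c),
          N.bcEmb_baseRes_coherent (T.hVW h) (T.hWZ h) (S.isOpen j) (T.hWV h) (T.hZZ h) (S.isOpen i)
            (T.hZb i) (T.hZb j) (c : N.base (S.V i)),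
          N.unitRes_bcUnits_constUnit (T.hVW h) (T.hWV h) c⟩
      isNFConstant_iff_mem := fun i c =>
        N.isNFConstant_iff_bcEmb_mem (S.isOpen i) (T.hZb i) hZ (S.isNFCurve i) (c : N.base (S.V i))
      baseEmb_exhaust := T.base_cofinal
      fnEmb := fun i => (N.toGeom (T.hZb i)).comp (N.fieldRes (S.isOpen i)).symm.toRingHom
      nfEmb := N.nfToGeom Z
      fnEmb_res := fun i j h f =>
        N.toGeom_fieldRes_coherent (T.hVW h) (T.hWZ h) (S.isOpen j) (T.hWV h) (T.hZZ h) (S.isOpen i)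
          (T.hZb i) (T.hZb j) ((f : (N.FunctionField (S.V i))ˣ) : N.FunctionField (S.V i))
      isNFRational_iff := fun i g => N.isNFRational_iff_toGeom_mem (S.isOpen i) (T.hZb i) hZ (S.isNFCurve i) g
      nfEmb_exhaust := T.fn_cofinal
      rich := T.rich }

/-- **Thm. 1.9 (d) for every law-abiding model with tagged systems**: the three (d)-rows
`Thm19d_inj ∧ Thm19d_functionField ∧ Thm19d_constants` of a `DescentKummerModel` from abc-iut-L4-t1's named
facts `Prop_1_6_i`, `Prop_1_8_i`, `Prop_1_8_ii`, `Prop_1_6_iii_units`, `Prop_1_6_iii_ker`, `Rmk_1_5_4_i` BY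
NAME, provided every directed system of NF-complements over a (d)-input `Z` carries geometric tags
(`GeomTags`: its bare homomorphisms are the model's open / base-change legs, and it is cofinal).
[cite: MochizukiAbsTopIII2015, Thm 1.9 (d) p.37] -/
theorem thm19d_of_tags (h18i : N.Prop_1_8_i) (h18ii : N.Prop_1_8_ii) (h16u : N.Prop_1_6_iii_units)
    (h16k : N.Prop_1_6_iii_ker) (h16 : N.Prop_1_6_i) (h154 : Rmk_1_5_4_i.{u})
    (hT : ∀ (Z : N.Curve), N.IsThm19dInput Z → ∀ (ι : Type u) [Preorder ι] [Nonempty ι]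
      [IsDirectedOrder ι] (S : CurveModel.NFComplementSystem N.toCurveModel Z ι), Nonempty (S.GeomTags N)) :
    N.Thm19d_inj ∧ N.Thm19d_functionField ∧ N.Thm19d_constants :=
  N.thm19d_of_tower h18i h18ii h16u h16k h16 h154 fun Z hZ ι _ _ _ S => by
    obtain ⟨T⟩ := hT Z hZ ι S
    exact exists_nfTower_of_tags S T hZ.isNFCurve

end DescentKummerModel

end Literature.AnabelianGeometry.AbsoluteAnabelian.AbsTopIII
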